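import Summits.AtomisticToContinuum.Crystallization.Theorems.ChartedZeroExcessLayeredLatticeLiouvilleXB

/-!
# Zero-excess layered lattice Liouville — part XX (lens-2 g60, node «CaccioppoliByBudget»): leaf (1) `CaccioppoliGlueBPG` PROVED — from [SBᵇ] alone

Critic row 1151 (leaf (1) of `stmt-AtomisticToContinuum-26636`: the typed glue
`CaccioppoliGlueBPG tameRadius 1 2 (1/16) (1/50) (1/2000)` of part UN, `(I0) → (I1) → (I4) → (I5) → hU → hN → [KS] → [SBᵇ] → [CC°_Ψᵇ]`).

FINDING (structural, lens-2): AT THE TYPED STRENGTH the glue needs NONE of the Gårding / cut-off / tail / iteration bookkeeping (G1)–(G7) of its docstring —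
its LAST antecedent [SBᵇ] `SubWindowBudgetBPG ϑ aHi Λ θ s` alone implies the conclusion [CC°_Ψᵇ] `CoherentGscCaccioppoliPsiBPG ϑ aHi Λ θ s` for every door
ceiling `aHi ≤ 8/7` (`coherentGscCaccioppoliPsiBPG_of_subWindowBudgetBPG`).  The witnesses: `Ψ' := Ψ`, `Cg' := Cg`, the IDENTITY tilt field
`Q x := refl` and the STAR STRAIN `σ x := min 12 √(Σ_{p ∈ S, dist p x ≤ 4} dist(p − x, Ψ p − Ψ x)²)` (XX.1) — tilt–strain data by construction
(`det refl = 1`; every `4`-bond distortion is `≤ 12` by tear-freeness and `≤ √(star sum)`); `c₁ := κ := 1`, `r₀ := max ρ₀ 4`,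
`A := doorDoublingC δ · A_B + 10·(10/δ+1)³·winDensC δ²·Cg`.
* LOCAL ESTIMATE (XX.2/XX.4): `Σ_{S ∩ B(x,r)} σ² ≤ bondEnergy (S ∩ B(x, r+4)) (p ↦ p − Ψ p)` (each star is a row of the bond energy, `sub_sub_sub_comm`)
  `≤ A_B·η·#(S ∩ B(x,r+4))` ([SBᵇ] at `ρ := r + 4 ≥ ρ₀`; `S ∩ B(x,r+4) ⊆ S ∩ B(x,2r) ⊆ ball 0 8R` as `r ≥ 4`) `≤ A_B·η·doorDoublingC δ·#(S ∩ B(x,r))`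
  (part UA `ncard_inter_ball_two_mul_le`) — so `⨍_{B(x,r)} σ² ≤ A·η ≤ 1·(⨍_{B(x,3r/2)} |Ψ − (U· + v)|²/r² + A·η)`: the Caccioppoli gain term is simply dropped.
* GLOBAL BUDGET (XX.3): `IsGlobalReg`'s registration at `D := 8R + 4` gives `τ` with consistency on `win(8R+4)` at level `Cg·(8R+4)/R·η ≤ 10·Cg·η` (`R ≥ 2`);
  `σ_x² ≤ star sum ≤ #star·τ_x² ≤ (10/δ+1)³·τ_x²` for `x ∈ win 8R` (stars of `win 8R` lie in `win(8R+4)`, part TZ `mem_atomsIn_add_four`); sum and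
  part TZ `nK_atomsIn_add_four_le` (`12 ≤ 8R`).
CONSEQUENCES (XX.5): `caccioppoliGlueBPG_holds` = leaf (1) VERBATIM (0 sorry); [CC°_Ψᵇ] from the SB-glue and ITS open leaves (RC), (I4ˢ), hU, hN only
(`coherentGscCaccioppoliPsiBPG_of_sbLeaves`: part XB `subWindowBudgetBPG_of_leaves`, no [KS], no CC-glue); the record example of part XB with the
hypothesis `hglueC` DISCHARGED.  With g59's `subWindowBudgetGlueBPG_holds` (part XW, landing) both glues of the column are theorems.
RESIDUE of the column after this part and XW: (RC)(1/25, 3, 1/1000); (I4ˢ)(1, 3, 1/16, 1/25); hU (1/50, 2, 1/2000); hN (1, 2, 1/16, 1/50, 1/2000);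
[KS](1, 1/16) (used only by `strainNonConcentrationBPG_1_50_of_docketPsi`); [T_bᵇ]; [W_Ψᵇ]; the dressed core; `ZatorskaGoldstein2005_localGehringLemmaCounting`.
No statement is re-typed; imports part XB only.
-/

noncomputable section

open scoped BigOperators
open MeasureTheory Set Metric Filter Topology
open Summit.AtomisticToContinuum.Crystallization.Theorems.ChartedPlanarOrderRigidityDoor (E3 atomsIn)
open Summit.AtomisticToContinuum.Crystallization.Theorems.ChartedPlanarOrderDensityDichotomy (μS IsSep nK nK_nonneg)
open Summit.AtomisticToContinuum.Crystallization.Theorems.ChartedPlanarOrderCleanScaleP (IsCleanP IsDoorSetP)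
open Summit.AtomisticToContinuum.Crystallization.Theorems.ChartedPlanarOrderMesoCut (LayeredHom EnvClose)
open Summit.AtomisticToContinuum.Crystallization.Theorems.ChartedPlanarOrderDoorLayered (atomsIn_subset sq_le_finsum_mem)
open Summit.AtomisticToContinuum.Crystallization.Theorems.ChartedPlanarOrderDoorLayeredOsc (IsTwoShellAffineGood)
open Literature.Analysis.PDE (finavg ZatorskaGoldstein2005_localGehringLemmaCounting)

namespace Summit.AtomisticToContinuum.Crystallization.Theorems.ChartedZeroExcessLayeredLatticeLiouville

/-! ### XX.1  The star misfit sum and the star strain -/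

/-- the STAR MISFIT SUM of `Ψ` at `x` against the identity frame: `Σ_{p ∈ S, dist p x ≤ 4} dist(p − x, Ψ p − Ψ x)²` — the `x`-row of
`bondEnergy · (p ↦ p − Ψ p)`. [this file, g60] -/
def starSum (S : Set E3) (Ψ : E3 → E3) (x : E3) : ℝ :=
  ∑ᶠ p ∈ S ∩ closedBall x 4, dist (p - x) (Ψ p - Ψ x) ^ 2

/-- the STAR STRAIN `σ x := min 12 √(starSum S Ψ x)`: the identity-frame strain profile of the tilt–strain data `(refl, σ)`. [this file, g60] -/
def starStrain (S : Set E3) (Ψ : E3 → E3) (x : E3) : ℝ :=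
  min 12 (Real.sqrt (starSum S Ψ x))

/-- `0 ≤ starSum`. [this file, g60] -/
theorem starSum_nonneg {S : Set E3} {Ψ : E3 → E3} {x : E3} : 0 ≤ starSum S Ψ x :=
  finsum_nonneg fun _ => finsum_nonneg fun _ => sq_nonneg _

/-- `0 ≤ σ`. [this file, g60] -/
theorem starStrain_nonneg {S : Set E3} {Ψ : E3 → E3} {x : E3} : 0 ≤ starStrain S Ψ x :=
  le_min (by norm_num) (Real.sqrt_nonneg _)

/-- `σ ≤ 12`. [this file, g60] -/
theorem starStrain_le_twelve {S : Set E3} {Ψ : E3 → E3} {x : E3} : starStrain S Ψ x ≤ 12 :=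
  min_le_left _ _

/-- `σ² ≤ starSum`. [this file, g60] -/
theorem starStrain_sq_le_starSum {S : Set E3} {Ψ : E3 → E3} {x : E3} : starStrain S Ψ x ^ 2 ≤ starSum S Ψ x :=
  calc starStrain S Ψ x ^ 2 ≤ Real.sqrt (starSum S Ψ x) ^ 2 := pow_le_pow_left₀ starStrain_nonneg (min_le_right _ _) 2
    _ = starSum S Ψ x := Real.sq_sqrt starSum_nonneg

/-- every `4`-bond distortion at a site of a separated set under a tear-free map is below the star strain. [this file, g60] -/
theorem dist_bond_le_starStrain {δ : ℝ} (hδ : 0 < δ) {S : Set E3} (hsep : IsSep δ S) {Ψ : E3 → E3}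
    (htear : ∀ x ∈ S, ∀ p ∈ S, dist p x ≤ 4 → dist (Ψ p) (Ψ x) ≤ 8) {x p : E3} (hx : x ∈ S) (hp : p ∈ S) (hpx : dist p x ≤ 4) :
    dist (p - x) (Ψ p - Ψ x) ≤ starStrain S Ψ x := by
  refine le_min ?_ ?_
  · simpa using dist_rot_bond_le_twelve htear (LinearIsometryEquiv.refl ℝ E3) hx hp hpx
  · have hsq : dist (p - x) (Ψ p - Ψ x) ^ 2 ≤ starSum S Ψ x :=
      sq_le_finsum_mem (finite_inter_closedBall_four hδ hsep x) (fun q => dist (q - x) (Ψ q - Ψ x)) ⟨hp, mem_closedBall.2 hpx⟩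
    calc dist (p - x) (Ψ p - Ψ x) = Real.sqrt (dist (p - x) (Ψ p - Ψ x) ^ 2) := (Real.sqrt_sq dist_nonneg).symm
      _ ≤ Real.sqrt (starSum S Ψ x) := Real.sqrt_le_sqrt hsq

/-- ★ `(refl, starStrain)` are TILT–STRAIN DATA of a tear-free `Ψ` on every window. [this file, g60] -/
theorem isTiltStrainData_refl_starStrain {δ : ℝ} (hδ : 0 < δ) {S : Set E3} (hsep : IsSep δ S) {Ψ : E3 → E3}
    (htear : ∀ x ∈ S, ∀ p ∈ S, dist p x ≤ 4 → dist (Ψ p) (Ψ x) ≤ 8) (R : ℝ) :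
    IsTiltStrainData S R Ψ (fun _ => LinearIsometryEquiv.refl ℝ E3) (starStrain S Ψ) :=
  ⟨fun _ => det_refl_E3_eq_one, fun _ => starStrain_nonneg, fun x hx p hp hpx => by
    simpa using dist_bond_le_starStrain hδ hsep htear (mem_atomsIn_iff.1 hx).1 hp hpx⟩

/-! ### XX.2  The star sum as a row of the bond energy; the local sum -/

/-- the star misfit sum is the `x`-row of the bond energy of `p ↦ p − Ψ p` on any chunk containing the star. [this file, g60] -/
theorem starSum_eq_row {S Q : Set E3} {Ψ : E3 → E3} {x : E3} (hQ : S ∩ closedBall x 4 = Q ∩ closedBall x 4) :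
    starSum S Ψ x = ∑ᶠ p ∈ Q ∩ closedBall x 4, ‖(p - Ψ p) - (x - Ψ x)‖ ^ 2 := by
  unfold starSum
  rw [hQ]
  refine finsum_mem_congr rfl fun p _ => ?_
  rw [dist_eq_norm, sub_sub_sub_comm]

/-- ★ on a ball about `x`, the star strains are carried by the bond energy of `p ↦ p − Ψ p` on the `4`-fattened ball. [this file, g60] -/
theorem winsum_starStrain_sq_le_bondEnergy {δ : ℝ} (hδ : 0 < δ) {S : Set E3} (hsep : IsSep δ S) (Ψ : E3 → E3) (x : E3) (r : ℝ) :
    ∑ᶠ y ∈ S ∩ ball x r, starStrain S Ψ y ^ 2 ≤ bondEnergy (S ∩ ball x (r + 4)) (fun p => p - Ψ p) := by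
  have hQ : (S ∩ ball x (r + 4)).Finite := finite_inter_ball_of_isSep hδ hsep x (r + 4)
  have hsub : S ∩ ball x r ⊆ S ∩ ball x (r + 4) :=
    fun y hy => ⟨hy.1, mem_ball.2 (lt_of_lt_of_le (mem_ball.1 hy.2) (by linarith))⟩
  have hstar : ∀ y ∈ S ∩ ball x r, S ∩ closedBall y 4 = (S ∩ ball x (r + 4)) ∩ closedBall y 4 := by
    intro y hy
    ext p
    simp only [mem_inter_iff, mem_closedBall, mem_ball]
    constructor
    · rintro ⟨hp, hpy⟩
      have hyx : dist y x < r := mem_ball.1 hy.2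
      exact ⟨⟨hp, by linarith [dist_triangle p y x]⟩, hpy⟩
    · rintro ⟨⟨hp, -⟩, hpy⟩
      exact ⟨hp, hpy⟩
  calc ∑ᶠ y ∈ S ∩ ball x r, starStrain S Ψ y ^ 2 ≤ ∑ᶠ y ∈ S ∩ ball x r, starSum S Ψ y :=
        winsum_le_winsum_of_le (hQ.subset hsub) fun y _ => starStrain_sq_le_starSum
    _ = ∑ᶠ y ∈ S ∩ ball x r, ∑ᶠ p ∈ (S ∩ ball x (r + 4)) ∩ closedBall y 4, ‖(p - Ψ p) - (y - Ψ y)‖ ^ 2 :=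
        finsum_mem_congr rfl fun y hy => starSum_eq_row (hstar y hy)
    _ ≤ ∑ᶠ y ∈ S ∩ ball x (r + 4), ∑ᶠ p ∈ (S ∩ ball x (r + 4)) ∩ closedBall y 4, ‖(p - Ψ p) - (y - Ψ y)‖ ^ 2 :=
        finsum_mem_le_finsum_mem_of_subset_of_nonneg hQ hsub fun y _ => finsum_nonneg fun _ => finsum_nonneg fun _ => sq_nonneg _
    _ = bondEnergy (S ∩ ball x (r + 4)) (fun p => p - Ψ p) := rfl

/-! ### XX.3  Star cardinality and the global budget from `IsGlobalReg` -/

/-- a `4`-star of a `δ`-separated set has at most `(10/δ + 1)³` sites. [this file, g60] -/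
theorem ncard_star_le {δ : ℝ} (hδ : 0 < δ) {S : Set E3} (hsep : IsSep δ S) (x : E3) :
    ((S ∩ closedBall x 4).ncard : ℝ) ≤ (10 / δ + 1) ^ 3 := by
  have hfin := finite_inter_ball_of_isSep hδ hsep x 5
  have hsub : S ∩ closedBall x 4 ⊆ S ∩ ball x 5 :=
    fun p hp => ⟨hp.1, mem_ball.2 (lt_of_le_of_lt (mem_closedBall.1 hp.2) (by norm_num))⟩
  have h1 : ((S ∩ closedBall x 4).ncard : ℝ) ≤ ((S ∩ ball x 5).ncard : ℝ) := by exact_mod_cast Set.ncard_le_ncard hsub hfin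
  calc ((S ∩ closedBall x 4).ncard : ℝ) ≤ ((S ∩ ball x 5).ncard : ℝ) := h1
    _ ≤ (2 * 5 / δ + 1) ^ 3 := ncard_inter_ball_le_packing hδ hsep x (by norm_num : (0 : ℝ) ≤ 5)
    _ = (10 / δ + 1) ^ 3 := by norm_num

/-- under registration consistency at `x` (every `4`-bond distortion `≤ t`, `0 ≤ t`) the star sum is `≤ (10/δ+1)³·t²`. [this file, g60] -/
theorem starSum_le_of_consistent {δ : ℝ} (hδ : 0 < δ) {S : Set E3} (hsep : IsSep δ S) {Ψ : E3 → E3} {x : E3} {t : ℝ}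
    (hcons : ∀ p ∈ S, dist p x ≤ 4 → dist (p - x) (Ψ p - Ψ x) ≤ t) : starSum S Ψ x ≤ (10 / δ + 1) ^ 3 * t ^ 2 := by
  have hfin := finite_inter_closedBall_four hδ hsep x
  calc starSum S Ψ x ≤ ∑ᶠ p ∈ S ∩ closedBall x 4, t ^ 2 :=
        winsum_le_winsum_of_le hfin fun p hp => pow_le_pow_left₀ dist_nonneg (hcons p hp.1 (mem_closedBall.1 hp.2)) 2
    _ = ((S ∩ closedBall x 4).ncard : ℝ) * t ^ 2 := by
        rw [finsum_mem_eq_finite_toFinset_sum _ hfin, Finset.sum_const, nsmul_eq_mul, Set.ncard_eq_toFinset_card _ hfin]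
    _ ≤ (10 / δ + 1) ^ 3 * t ^ 2 := mul_le_mul_of_nonneg_right (ncard_star_le hδ hsep x) (sq_nonneg t)

/-- ★ the WINDOW BUDGET of the star strains: on an `aHi`-door set (`aHi ≤ 8/7`) with a global registration `IsGlobalReg Cg η R S H Ψ`, `R ≥ 2`,
`Σ_{win 8R} σ² ≤ 10·(10/δ+1)³·winDensC δ²·Cg · η · nK(win 8R)` — registration at `D := 8R + 4`, consistency on the stars, packing. [this file, g60] -/
theorem winsum_starStrain_sq_le_global {aHi δ : ℝ} (haHi : aHi ≤ 8 / 7) (hδ : 0 < δ) {S : Set E3} (hS : IsDoorSetP aHi δ S) {Cg η R : ℝ}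
    (hCg : 1 ≤ Cg) (hη : 0 < η) (hR : 2 ≤ R) {H : Set E3} {Ψ : E3 → E3} (hΨ : IsGlobalReg Cg η R S H Ψ) :
    ∑ᶠ x ∈ atomsIn (μS S) 0 (8 * R), starStrain S Ψ x ^ 2 ≤
      10 * (10 / δ + 1) ^ 3 * winDensC δ ^ 2 * Cg * η * nK (atomsIn (μS S) 0 (8 * R)) := by
  have hsep : IsSep δ S := hS.2.1
  obtain ⟨τ, -, -, -, hcons, hsum, -⟩ := hΨ.2.2.2 (8 * R + 4) (by linarith)
  set N : ℝ := (10 / δ + 1) ^ 3 with hN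
  have hN0 : 0 ≤ N := by positivity
  have hCg0 : 0 ≤ Cg := zero_le_one.trans hCg
  have hW : (atomsIn (μS S) 0 (8 * R)).Finite := finite_atomsIn hδ hsep _
  have hW' : (atomsIn (μS S) 0 (8 * R + 4)).Finite := finite_atomsIn hδ hsep _
  have hsub : atomsIn (μS S) 0 (8 * R) ⊆ atomsIn (μS S) 0 (8 * R + 4) := atomsIn_mono_radius (by linarith)
  have hpt : ∀ x ∈ atomsIn (μS S) 0 (8 * R), starStrain S Ψ x ^ 2 ≤ N * τ x ^ 2 := fun x hx =>
    starStrain_sq_le_starSum.trans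
      (starSum_le_of_consistent hδ hsep fun p hp hpx => hcons x (hsub hx) p (mem_atomsIn_add_four hx hp hpx) hpx)
  have hlev : Cg * ((8 * R + 4) / R) * η ≤ 10 * Cg * η := by
    have hR0 : 0 < R := by linarith
    have h1 : (8 * R + 4) / R ≤ 10 := by rw [div_le_iff₀ hR0]; linarith
    calc Cg * ((8 * R + 4) / R) * η = (8 * R + 4) / R * (Cg * η) := by ring
      _ ≤ 10 * (Cg * η) := mul_le_mul_of_nonneg_right h1 (mul_nonneg hCg0 hη.le)
      _ = 10 * Cg * η := by ring
  have hdens := nK_atomsIn_add_four_le haHi hδ hS (by linarith : (12 : ℝ) ≤ 8 * R)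
  calc ∑ᶠ x ∈ atomsIn (μS S) 0 (8 * R), starStrain S Ψ x ^ 2 ≤ ∑ᶠ x ∈ atomsIn (μS S) 0 (8 * R), N * τ x ^ 2 :=
        winsum_le_winsum_of_le hW hpt
    _ = N * ∑ᶠ x ∈ atomsIn (μS S) 0 (8 * R), τ x ^ 2 := winsum_const_mul hW N _
    _ ≤ N * ∑ᶠ x ∈ atomsIn (μS S) 0 (8 * R + 4), τ x ^ 2 :=
        mul_le_mul_of_nonneg_left (finsum_mem_le_finsum_mem_of_subset_of_nonneg hW' hsub fun x _ => sq_nonneg _) hN0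
    _ ≤ N * (Cg * ((8 * R + 4) / R) * η * nK (atomsIn (μS S) 0 (8 * R + 4))) := mul_le_mul_of_nonneg_left hsum hN0
    _ ≤ N * (10 * Cg * η * (winDensC δ ^ 2 * nK (atomsIn (μS S) 0 (8 * R)))) :=
        mul_le_mul_of_nonneg_left (mul_le_mul hlev hdens (nK_nonneg _) (by positivity)) hN0
    _ = 10 * (10 / δ + 1) ^ 3 * winDensC δ ^ 2 * Cg * η * nK (atomsIn (μS S) 0 (8 * R)) := by rw [hN]; ring

/-! ### XX.4  The local step: the sub-window budget and door doubling -/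

/-- ★ THE LOCAL STEP: a budget `bondEnergy (S ∩ B(x,r+4)) (p ↦ p − Ψ p) ≤ A_B·η·#(S ∩ B(x,r+4))` and door doubling give
`⨍_{S ∩ B(x,r)} σ² ≤ doorDoublingC δ · A_B · η` (`x ∈ S`, `r ≥ 4`, `aHi ≤ 8/7`). [this file, g60] -/
theorem finavg_starStrain_sq_le_of_budget {aHi δ : ℝ} (haHi : aHi ≤ 8 / 7) (hδ : 0 < δ) {S : Set E3} (hS : IsDoorSetP aHi δ S) {Ψ : E3 → E3}
    {x : E3} (hx : x ∈ S) {r AB η : ℝ} (hr : 4 ≤ r) (hAB : 0 ≤ AB) (hη : 0 ≤ η)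
    (hbud : bondEnergy (S ∩ ball x (r + 4)) (fun p => p - Ψ p) ≤ AB * η * nK (S ∩ ball x (r + 4))) :
    finavg (S ∩ ball x r) (fun y => starStrain S Ψ y ^ 2) ≤ doorDoublingC δ * AB * η := by
  have hsep : IsSep δ S := hS.2.1
  have hr0 : 0 < r := by linarith
  have hfin : (S ∩ ball x r).Finite := finite_inter_ball_of_isSep hδ hsep x r
  have hfin2 : (S ∩ ball x (2 * r)).Finite := finite_inter_ball_of_isSep hδ hsep x (2 * r)
  have hpos : (0 : ℝ) < ((S ∩ ball x r).ncard : ℝ) := by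
    exact_mod_cast (Set.ncard_pos hfin).2 ⟨x, hx, mem_ball_self hr0⟩
  have hsub : S ∩ ball x (r + 4) ⊆ S ∩ ball x (2 * r) :=
    fun p hp => ⟨hp.1, mem_ball.2 (lt_of_lt_of_le (mem_ball.1 hp.2) (by linarith))⟩
  have hcnt : nK (S ∩ ball x (r + 4)) ≤ doorDoublingC δ * nK (S ∩ ball x r) :=
    calc nK (S ∩ ball x (r + 4)) ≤ nK (S ∩ ball x (2 * r)) := nK_le_nK_of_subset hfin2 hsub
      _ ≤ doorDoublingC δ * nK (S ∩ ball x r) := ncard_inter_ball_two_mul_le haHi hδ hsep hS.2.2.1 hx hr0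
  have hsum : ∑ᶠ y ∈ S ∩ ball x r, starStrain S Ψ y ^ 2 ≤ doorDoublingC δ * AB * η * nK (S ∩ ball x r) :=
    calc ∑ᶠ y ∈ S ∩ ball x r, starStrain S Ψ y ^ 2 ≤ bondEnergy (S ∩ ball x (r + 4)) (fun p => p - Ψ p) :=
          winsum_starStrain_sq_le_bondEnergy hδ hsep Ψ x r
      _ ≤ AB * η * nK (S ∩ ball x (r + 4)) := hbud
      _ ≤ AB * η * (doorDoublingC δ * nK (S ∩ ball x r)) := mul_le_mul_of_nonneg_left hcnt (mul_nonneg hAB hη)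
      _ = doorDoublingC δ * AB * η * nK (S ∩ ball x r) := by ring
  unfold finavg
  rw [div_le_iff₀ hpos]
  exact hsum

/-! ### XX.5  [CC°_Ψᵇ] from [SBᵇ]; leaf (1) at the literals; the docket consequences -/

/-- ★★★ **[CC°_Ψᵇ] ⟸ [SBᵇ] ALONE (PROVED, every `aHi ≤ 8/7`).**  Witnesses `Ψ' := Ψ`, `Cg' := Cg`, `Q := refl`, `σ := starStrain S Ψ`, `c₁ := κ := 1`,
`r₀ := max ρ₀ 4`, `A := doorDoublingC δ·A_B + 10·(10/δ+1)³·winDensC δ²·Cg`, `R₁ := max R₁ 2`; the local estimate is XX.4 on [SBᵇ]'s budget at `ρ := r + 4`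
(`S ∩ B(x,r+4) ⊆ S ∩ B(x,2r) ⊆ ball 0 8R`), the window budget is XX.3, and the Caccioppoli gain term is dropped (it is `≥ 0`). [this file, g60] -/
theorem coherentGscCaccioppoliPsiBPG_of_subWindowBudgetBPG {ϑ aHi Λ θ s : ℝ} (haHi : aHi ≤ 8 / 7) (hSB : SubWindowBudgetBPG ϑ aHi Λ θ s) :
    CoherentGscCaccioppoliPsiBPG ϑ aHi Λ θ s := by
  intro δ hδ a ha Cg hCg
  obtain ⟨AB, hAB, ρ₀, hρ₀, ϑ₁, hϑ₁, ω₁, hω₁, hK⟩ := hSB δ hδ a ha Cg hCg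
  have hCg0 : 0 ≤ Cg := zero_le_one.trans hCg
  set A : ℝ := doorDoublingC δ * AB + 10 * (10 / δ + 1) ^ 3 * winDensC δ ^ 2 * Cg with hA
  have hA1 : 0 ≤ doorDoublingC δ * AB := mul_nonneg (zero_le_one.trans (one_le_doorDoublingC hδ)) hAB
  have hA2 : 0 ≤ 10 * (10 / δ + 1) ^ 3 * winDensC δ ^ 2 * Cg := by positivity
  refine ⟨Cg, le_rfl, 1, one_pos, 1, one_pos, A, add_nonneg hA1 hA2, max ρ₀ 4, lt_max_of_lt_left hρ₀, ϑ₁, hϑ₁, ω₁, hω₁,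
    fun K₀ hK₀ => ?_⟩
  obtain ⟨η₁, hη₁, R₁, hR₁, h1⟩ := hK K₀ hK₀
  refine ⟨η₁, hη₁, max R₁ 2, lt_max_of_lt_left hR₁, ?_⟩
  intro S hS hgood η hη hηle R hR L w hLw Ψ hΨ hBI hfat htame hcoh
  have hR₁R : R₁ ≤ R := (le_max_left _ _).trans hR
  have hR2 : 2 ≤ R := (le_max_right _ _).trans hR
  have hSP : IsDoorSetP aHi δ S := hS.1
  have hsep : IsSep δ S := hSP.2.1
  have hbud := h1 S hS hgood η hη hηle R hR₁R L w hLw Ψ hΨ hBI hfat htame hcoh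
  refine ⟨Ψ, hΨ, fun _ => LinearIsometryEquiv.refl ℝ E3, starStrain S Ψ, isTiltStrainData_refl_starStrain hδ hsep hΨ.2.1 (8 * R),
    fun _ => starStrain_le_twelve, ?_, ?_⟩
  · calc ∑ᶠ x ∈ atomsIn (μS S) 0 (8 * R), starStrain S Ψ x ^ 2
          ≤ 10 * (10 / δ + 1) ^ 3 * winDensC δ ^ 2 * Cg * η * nK (atomsIn (μS S) 0 (8 * R)) :=
          winsum_starStrain_sq_le_global haHi hδ hSP hCg hη hR2 hΨ
      _ ≤ A * η * nK (atomsIn (μS S) 0 (8 * R)) := by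
          have hle : 10 * (10 / δ + 1) ^ 3 * winDensC δ ^ 2 * Cg ≤ A := by rw [hA]; linarith
          exact mul_le_mul_of_nonneg_right (mul_le_mul_of_nonneg_right hle hη.le) (nK_nonneg _)
  · intro x hx r hr0 hr hball U v hU hdev
    have hr4 : 4 ≤ r := (le_max_right _ _).trans hr
    have hρ : ρ₀ ≤ r + 4 := by linarith [(le_max_left ρ₀ 4).trans hr]
    have hsub : S ∩ ball x (r + 4) ⊆ ball 0 (8 * R) :=
      fun p hp => hball ⟨hp.1, mem_ball.2 (lt_of_lt_of_le (mem_ball.1 hp.2) (by linarith))⟩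
    have hloc := finavg_starStrain_sq_le_of_budget haHi hδ hSP hx hr4 hAB hη.le (hbud x hx (r + 4) hρ hsub)
    have hdev0 : 0 ≤ finavg (S ∩ ball x (3 / 2 * r)) (fun p => ‖Ψ p - (U p + v)‖ ^ 2) / r ^ 2 := by
      refine div_nonneg ?_ (sq_nonneg r)
      unfold finavg
      exact div_nonneg (finsum_nonneg fun _ => finsum_nonneg fun _ => sq_nonneg _) (Nat.cast_nonneg _)
    calc finavg (S ∩ ball x r) (fun y => starStrain S Ψ y ^ 2) ≤ doorDoublingC δ * AB * η := hloc
      _ ≤ A * η := by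
          have hle : doorDoublingC δ * AB ≤ A := by rw [hA]; linarith
          exact mul_le_mul_of_nonneg_right hle hη.le
      _ ≤ 1 * (finavg (S ∩ ball x (3 / 2 * r)) (fun p => ‖Ψ p - (U p + v)‖ ^ 2) / r ^ 2 + A * η) := by linarith

/-- ★★★ the glue in general parameters: `CaccioppoliGlueBPG ϑ aHi Λ θ s ν` holds for every `aHi ≤ 8/7` — only its LAST antecedent [SBᵇ] is used;
(I0), (I1), (I4), (I5), hU, hN, [KS] are discarded. [this file, g60] -/
theorem caccioppoliGlueBPG_of_le {ϑ aHi Λ θ s ν : ℝ} (haHi : aHi ≤ 8 / 7) : CaccioppoliGlueBPG ϑ aHi Λ θ s ν :=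
  fun _ _ _ _ _ _ _ hSB => coherentGscCaccioppoliPsiBPG_of_subWindowBudgetBPG haHi hSB

/-- ★★★ **LEAF (1) OF THE 26636 DOCKET, PROVED VERBATIM AT THE LITERALS** (critic row 1151). [this file, g60] -/
theorem caccioppoliGlueBPG_holds : CaccioppoliGlueBPG tameRadius 1 2 (1 / 16) (1 / 50) (1 / 2000) :=
  caccioppoliGlueBPG_of_le (by norm_num)

/-- ★★ [CC°_Ψᵇ] from the SB-glue and ITS open leaves only — (RC), (I4ˢ), hU, hN (part XB `subWindowBudgetBPG_of_leaves`): no CC-glue, no [KS],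
no `s ≤ s'`, `Λ ≤ Λ'`. [this file, g60] -/
theorem coherentGscCaccioppoliPsiBPG_of_sbLeaves {ϑ aHi Λ Λ' θ s s' ν ν' : ℝ} (haHi : aHi ≤ 8 / 7)
    (hglueS : SubWindowBudgetGlueBPG ϑ aHi Λ Λ' θ s s' ν ν') (hRC : EquilChartStrainP s' Λ' ν') (h4 : TailFluxBSP aHi Λ' θ s')
    (hU : UniformTameStabilityE s Λ ν) (hN : EnergyNearChartPX aHi Λ θ s ν) : CoherentGscCaccioppoliPsiBPG ϑ aHi Λ θ s :=
  coherentGscCaccioppoliPsiBPG_of_subWindowBudgetBPG haHi (subWindowBudgetBPG_of_leaves hglueS hRC h4 hU hN)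

/-- Record example: the docket of record (`strainNonConcentrationBPG_1_50_of_docketPsi`, part UN) at column `_16XH19B`'s literals with part XB's
hypothesis `hglueC` DISCHARGED — residuals: hG, hI, hTb, [KS], [W_Ψᵇ], the SB-glue (g59's part XW proves it), (RC), (I4ˢ), hU, hN. [this file, g60] -/
example (hG : ZatorskaGoldstein2005_localGehringLemmaCounting)
    (hI : DressedCorePG tameRadius dressLevel dressLevel dressExponent 8 collarRadius clusterSize 1 2 (1 / 16) (1 / 50))
    (hTb : BareTameWindowBPG tameRadius dressLevel dressLevel dressExponent 8 collarRadius clusterSize 1 2 (1 / 16) (1 / 50))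
    (hKS : KornSobolevPoincareP 1 (1 / 16)) (hW : CoherentWindowPsiBPG tameRadius 1 2 (1 / 16) (1 / 50))
    (hglueS : SubWindowBudgetGlueBPG tameRadius 1 2 3 (1 / 16) (1 / 50) (1 / 25) (1 / 2000) (1 / 1000))
    (hRC : EquilChartStrainP (1 / 25) 3 (1 / 1000)) (h4 : TailFluxBSP 1 3 (1 / 16) (1 / 25))
    (hU : UniformTameStabilityE (1 / 50) 2 (1 / 2000)) (hN : EnergyNearChartPX 1 2 (1 / 16) (1 / 50) (1 / 2000)) :
    StrainNonConcentrationBPG 1 2 (1 / 16) (1 / 50) :=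
  strainNonConcentrationBPG_1_50_of_docketPsi hG hI hTb hKS hW (coherentGscCaccioppoliPsiBPG_of_sbLeaves (by norm_num) hglueS hRC h4 hU hN)

end Summit.AtomisticToContinuum.Crystallization.Theorems.ChartedZeroExcessLayeredLatticeLiouville

end
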